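import Mathlib.Data.ZMod.Basic
import Mathlib.Algebra.Group.Subgroup.Basic
import Mathlib.Algebra.BigOperators.Pi
import Mathlib.Algebra.BigOperators.Fin
import Mathlib.Algebra.BigOperators.Ring.Finset
import Mathlib.Algebra.Group.Pi.Lemmas
import Mathlib.Tactic.NormNum
import Mathlib.Tactic.FinCases
import Mathlib.Tactic.Ring
import HarnessLib

/-!
# Venture HSemireg — the translation lattices of the residual-lift monodromy (CC note §26.7 (M5))

Seat w1-tw-1 of the computation cell `pub-hsemireg` (W1 «twisted sheaves», CC note §26.7 (M) of
`widen/W1/CLEAN-COMPONENT-THEOREM-w1tw1.md`). There the monodromy of the 256 residual lifts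
`a ∈ (ℤ∕4)⁴` of the Brill–Noether surface acts by affine maps `a ↦ τ·a + c`, and two finite
bookkeeping facts about translation subgroups of `(ℤ∕4)⁴` are used:

* `mem_closure_pairSums_iff` — the subgroup generated by the pair vectors `e_j + e_k` (`j ≠ k`) is
  `E = {c : 2·Σ c_k = 0}` (the «even total» translations; 128 elements);
* `mem_closure_pairDiffs_iff` — the subgroup generated by the differences `(e_j + e_k) − (e_l + e_m)`
  of pair vectors (together with their sums and the doubles `2e_j + 2e_k`, which it already
  contains) is `E₀ = {c : Σ c_k = 0}` (64 elements).

The easy inclusions are proved for `Fin n → ZMod 4`, any `n`; the two characterisations at `n = 4`,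
where the note uses them; the decompositions are explicit (no `decide` over the 256-element group —
the only `decide`s are identities in `ZMod 4` and `2d = 0 ⇒ d ∈ {0, 2}`).

HONEST FRAMING. Elementary bookkeeping in a finite abelian group; no curve, Jacobian, theta divisor
or semiregularity map appears; nothing here says that HC, HC_CM or HC_AV holds, and nothing here is
a new case of anything.
-/

namespace Summit.Ventures.HSemireg

namespace ResidualLiftTranslationLattice

open Finset

/-- The pair vector `e_j + e_k` in `Fin n → ZMod 4`. -/
def pairVec {n : ℕ} (j k : Fin n) : Fin n → ZMod 4 := Pi.single j 1 + Pi.single k 1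

/-- The set of pair vectors `e_j + e_k`, `j ≠ k`. -/
def pairSums (n : ℕ) : Set (Fin n → ZMod 4) := {v | ∃ j k : Fin n, j ≠ k ∧ v = pairVec j k}

/-- The set of differences of two pair vectors. -/
def pairDiffs (n : ℕ) : Set (Fin n → ZMod 4) :=
  {v | ∃ j k l m : Fin n, j ≠ k ∧ l ≠ m ∧ v = pairVec j k - pairVec l m}

/-- A pair vector has coordinate sum `2`. -/
theorem sum_pairVec {n : ℕ} (j k : Fin n) : ∑ i, pairVec j k i = 2 := by
  simp only [pairVec, Pi.add_apply, sum_add_distrib, sum_pi_single', mem_univ, if_true]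
  rfl

/-- Every element of the subgroup generated by the pair vectors has even coordinate sum. -/
theorem two_mul_sum_eq_zero_of_mem_closure_pairSums {n : ℕ} {c : Fin n → ZMod 4}
    (hc : c ∈ AddSubgroup.closure (pairSums n)) : 2 * ∑ i, c i = 0 := by
  induction hc using AddSubgroup.closure_induction with
  | mem x hx =>
      obtain ⟨j, k, -, rfl⟩ := hx
      rw [sum_pairVec]; decide
  | zero => simp
  | add x y _ _ hx hy => simp only [Pi.add_apply, sum_add_distrib, mul_add, hx, hy, add_zero]
  | neg x _ hx => simp only [Pi.neg_apply, sum_neg_distrib, mul_neg, hx, neg_zero]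

/-- Every element of the subgroup generated by differences of pair vectors has zero coordinate sum. -/
theorem sum_eq_zero_of_mem_closure_pairDiffs {n : ℕ} {c : Fin n → ZMod 4}
    (hc : c ∈ AddSubgroup.closure (pairDiffs n)) : ∑ i, c i = 0 := by
  induction hc using AddSubgroup.closure_induction with
  | mem x hx =>
      obtain ⟨j, k, l, m, -, -, rfl⟩ := hx
      simp only [Pi.sub_apply, sum_sub_distrib, sum_pairVec, sub_self]
  | zero => simp
  | add x y _ _ hx hy => simp only [Pi.add_apply, sum_add_distrib, hx, hy, add_zero]
  | neg x _ hx => simp only [Pi.neg_apply, sum_neg_distrib, hx, neg_zero]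

/-- Scalar multiplication by `a : ZMod 4` on vectors is `a.val`-fold addition. -/
theorem zmod_smul_eq_nsmul {n : ℕ} (a : ZMod 4) (v : Fin n → ZMod 4) : a • v = a.val • v := by
  funext i
  simp only [Pi.smul_apply, smul_eq_mul, nsmul_eq_mul, ZMod.natCast_zmod_val]

/-- Pair vectors lie in the subgroup they generate. -/
theorem pairVec_mem_closure_pairSums {n : ℕ} {j k : Fin n} (h : j ≠ k) :
    pairVec j k ∈ AddSubgroup.closure (pairSums n) :=
  AddSubgroup.subset_closure ⟨j, k, h, rfl⟩

/-- Subgroups of `Fin n → ZMod 4` are closed under the `ZMod 4`-action. -/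
theorem smul_mem_of_mem {n : ℕ} (H : AddSubgroup (Fin n → ZMod 4)) (a : ZMod 4)
    {v : Fin n → ZMod 4} (hv : v ∈ H) : a • v ∈ H := by
  rw [zmod_smul_eq_nsmul]
  exact H.nsmul_mem hv _

/-- In `ZMod 4`, `2d = 0` forces `d ∈ {0, 2}`. -/
theorem eq_zero_or_eq_two_of_two_mul_eq_zero (d : ZMod 4) (h : 2 * d = 0) : d = 0 ∨ d = 2 := by
  revert d; decide

/-- The explicit decomposition of a vector of `(ℤ∕4)⁴` along `e₀+e₃, e₁+e₃, e₂+e₃` and `e₃`. -/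
theorem decomp_pairSums (c : Fin 4 → ZMod 4) :
    c = c 0 • pairVec 0 3 + c 1 • pairVec 1 3 + c 2 • pairVec 2 3
        + (c 3 - c 0 - c 1 - c 2) • Pi.single 3 1 := by
  funext i
  fin_cases i <;> simp [pairVec]

/-- `2e₃` is a combination of pair vectors: `(e₀+e₃) + (e₁+e₃) − (e₀+e₁)`. -/
theorem two_single_three_eq :
    (2 : ZMod 4) • (Pi.single 3 1 : Fin 4 → ZMod 4) = pairVec 0 3 + pairVec 1 3 - pairVec 0 1 := by
  funext i
  fin_cases i <;> simp [pairVec]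
  decide

/-- CC note §26.7 (M5), lattice `E`: in `(ℤ∕4)⁴` the subgroup generated by the pair vectors
`e_j + e_k` (`j ≠ k`) is exactly the set of vectors with even coordinate sum. -/
theorem mem_closure_pairSums_iff (c : Fin 4 → ZMod 4) :
    c ∈ AddSubgroup.closure (pairSums 4) ↔ 2 * ∑ i, c i = 0 := by
  refine ⟨two_mul_sum_eq_zero_of_mem_closure_pairSums, fun h => ?_⟩
  set H := AddSubgroup.closure (pairSums 4) with hH
  have h03 : pairVec (0 : Fin 4) 3 ∈ H := pairVec_mem_closure_pairSums (by decide)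
  have h13 : pairVec (1 : Fin 4) 3 ∈ H := pairVec_mem_closure_pairSums (by decide)
  have h23 : pairVec (2 : Fin 4) 3 ∈ H := pairVec_mem_closure_pairSums (by decide)
  have h01 : pairVec (0 : Fin 4) 1 ∈ H := pairVec_mem_closure_pairSums (by decide)
  have hsum : ∑ i, c i = c 0 + c 1 + c 2 + c 3 := by
    simp [Fin.sum_univ_four]
  have hd : 2 * (c 3 - c 0 - c 1 - c 2) = 0 := by
    have : 2 * (c 3 - c 0 - c 1 - c 2) = 2 * (c 0 + c 1 + c 2 + c 3) - 4 * (c 0 + c 1 + c 2) := by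
      ring
    rw [this, ← hsum, h, zero_sub, neg_eq_zero]
    have h4 : (4 : ZMod 4) = 0 := by decide
    rw [h4, zero_mul]
  have hlast : (c 3 - c 0 - c 1 - c 2) • (Pi.single 3 1 : Fin 4 → ZMod 4) ∈ H := by
    rcases eq_zero_or_eq_two_of_two_mul_eq_zero _ hd with h0 | h2
    · rw [h0, zmod_smul_eq_nsmul, ZMod.val_zero, zero_nsmul]; exact H.zero_mem
    · rw [h2, two_single_three_eq]
      exact H.sub_mem (H.add_mem h03 h13) h01
  rw [decomp_pairSums c]
  exact H.add_mem (H.add_mem (H.add_mem (smul_mem_of_mem H _ h03) (smul_mem_of_mem H _ h13))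
    (smul_mem_of_mem H _ h23)) hlast

/-- Differences of pair vectors lie in the subgroup they generate. -/
theorem pairDiff_mem_closure_pairDiffs {n : ℕ} {j k l m : Fin n} (h : j ≠ k) (h' : l ≠ m) :
    pairVec j k - pairVec l m ∈ AddSubgroup.closure (pairDiffs n) :=
  AddSubgroup.subset_closure ⟨j, k, l, m, h, h', rfl⟩

/-- The explicit decomposition along `e_i − e₃ = (e_i + e_j) − (e_j + e₃)` and `e₃`. -/
theorem decomp_pairDiffs (c : Fin 4 → ZMod 4) :
    c = c 0 • (pairVec 0 1 - pairVec 1 3) + c 1 • (pairVec 1 0 - pairVec 0 3)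
        + c 2 • (pairVec 2 0 - pairVec 0 3) + (c 0 + c 1 + c 2 + c 3) • Pi.single 3 1 := by
  funext i
  fin_cases i <;> simp [pairVec]
  ring

/-- CC note §26.7 (M5), lattice `E₀`: in `(ℤ∕4)⁴` the subgroup generated by the differences
`(e_j + e_k) − (e_l + e_m)` of pair vectors is exactly the set of vectors with zero coordinate sum. -/
theorem mem_closure_pairDiffs_iff (c : Fin 4 → ZMod 4) :
    c ∈ AddSubgroup.closure (pairDiffs 4) ↔ ∑ i, c i = 0 := by
  refine ⟨sum_eq_zero_of_mem_closure_pairDiffs, fun h => ?_⟩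
  set H := AddSubgroup.closure (pairDiffs 4) with hH
  have hsum : ∑ i, c i = c 0 + c 1 + c 2 + c 3 := by
    simp [Fin.sum_univ_four]
  have g0 : pairVec (0 : Fin 4) 1 - pairVec 1 3 ∈ H :=
    pairDiff_mem_closure_pairDiffs (by decide) (by decide)
  have g1 : pairVec (1 : Fin 4) 0 - pairVec 0 3 ∈ H :=
    pairDiff_mem_closure_pairDiffs (by decide) (by decide)
  have g2 : pairVec (2 : Fin 4) 0 - pairVec 0 3 ∈ H :=
    pairDiff_mem_closure_pairDiffs (by decide) (by decide)
  rw [decomp_pairDiffs c, ← hsum, h, zmod_smul_eq_nsmul (0 : ZMod 4), ZMod.val_zero, zero_nsmul,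
    add_zero]
  exact H.add_mem (H.add_mem (smul_mem_of_mem H _ g0) (smul_mem_of_mem H _ g1))
    (smul_mem_of_mem H _ g2)

/-- The sums `(e_j + e_k) + (e_l + e_m)` and the doubles `2e_j + 2e_k` also lie in the `E₀` lattice
(they have coordinate sum `4 = 0`), so adding them as generators changes nothing — as used in the
note, where the conjugates `(swap; e_j + e_k)` multiply to `(id; (e_j + e_k) ± (e_l + e_m))` and the
`S_a`-inertia contributes `(id; 2e_j + 2e_k)`. -/
theorem pairVec_add_pairVec_mem_closure_pairDiffs {j k l m : Fin 4} :
    pairVec j k + pairVec l m ∈ AddSubgroup.closure (pairDiffs 4) := by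
  rw [mem_closure_pairDiffs_iff]
  simp only [Pi.add_apply, sum_add_distrib, sum_pairVec]
  decide

/-- The doubles `2e_j + 2e_k` (the `S_a`-inertia translations of the note) lie in `E₀`. -/
theorem two_smul_pairVec_mem_closure_pairDiffs {j k : Fin 4} :
    (2 : ZMod 4) • pairVec j k ∈ AddSubgroup.closure (pairDiffs 4) := by
  rw [mem_closure_pairDiffs_iff]
  simp only [Pi.smul_apply, smul_eq_mul, ← Finset.mul_sum, sum_pairVec]
  decide

/-- `E₀ ≤ E`: zero coordinate sum implies even coordinate sum, and the inclusion is strict (the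
pair vectors themselves have sum `2 ≠ 0`) — the index-two step of the note. -/
theorem closure_pairDiffs_le_closure_pairSums :
    AddSubgroup.closure (pairDiffs 4) ≤ AddSubgroup.closure (pairSums 4) := by
  intro c hc
  rw [mem_closure_pairSums_iff]
  rw [mem_closure_pairDiffs_iff] at hc
  rw [hc, mul_zero]

/-- A single pair vector is NOT in `E₀` (coordinate sum `2`): `E₀ < E` strictly. -/
theorem pairVec_not_mem_closure_pairDiffs {j k : Fin 4} :
    pairVec j k ∉ AddSubgroup.closure (pairDiffs 4) := by
  rw [mem_closure_pairDiffs_iff, sum_pairVec]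
  decide

end ResidualLiftTranslationLattice

end Summit.Ventures.HSemireg
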